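import Summits.QuantumFields.QCD.Theorems.WilsonMobilityGapMobilityGapSketchDeepWindowComp
import Summits.QuantumFields.QCD.Theorems.WilsonMobilityGapMobilityGapSketchWindowDOS

/-!
# `stub_deepWindowAt` (skeleton v6, line `Sketch`, crux stmt-QuantumFields-9150) — AUDIT facts and STRUCTURE (part 1 of 2;
# registered sub-goal `extinctLaw_of_deepWindowLawTwelfth_three`)

Stub-worker W4 audit of the registered stub `stub_deepWindowAt` (skeleton v6), landed by the lead in two parts: this file (§A, audit and
structure; last theorem = registered sub-goal `extinctLaw_of_deepWindowLawTwelfth_three`) and `…SketchDeepWindowDOS.lean` (§R, the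
Wegner/DOS reduction; sub-goal `deepWindowLaw_of_crossingDOSLaw_three`); the stub itself is open-problem class.
Kernel-checked facts (also backing the evidence note `stub_deepWindowAt-DIAG.md` on the crux item):

* §A audit.  The `∃ L`-prefix is inhabited by the floor (landed `windowAt_prefix_inhabited`, any `N_f`).  The
  WINDOW count vanishes on the degenerate diagonal (`spreadCount_eq_zero_of_forall_eq`); the DEEP count vanishes
  as soon as one bare mass is `≥ 0` and the WINDOW count as soon as all are (`deepCount_eq_zero_of_exists_nonneg`,
  `spreadCount_eq_zero_of_forall_nonneg`; real spectrum of `D_W(U,0,1)` in `[0,8]`), so the body of the stub is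
  `0 ≤ 1/4` on triples `t ≥ 0` (`deepWindowBody_of_forall_nonneg`): content only while `thrD d δ k < 0`.
  STRUCTURE: `#deep + #window ≤ #{real modes below SOME −t_f}` for every multiset, with EQUALITY unless a root sits
  exactly at `−max t`, where the phase-quenched weight `Π_f |det D_W(t_f)|` vanishes; hence the v6 integrand equals
  `#{z : Im z = 0, Re z < −min_f t_f} · Π_f |det D_W(t_f)|` POINTWISE (`deepWindowIntegrand_eq_existsIntegrand`), and
  v5's flavour-summed integrand is at most `3×` it (`extinctIntegrand_le_three_mul_deepWindowIntegrand`):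
  v5 (`≤ 1/4`) ⟹ v6 (`≤ 1/4`) ⟹ v5 (`≤ 3/4`).
* §R reduction to WEGNER/DOS FORM via the landed coarea line of crux `TipPricing` (as `…SketchWindowDOS.lean` did for
  `N_f = 2`): one generic transfer lemma (`countIntegral_le_of_DOS`) and its three instances — DEEP alone from the
  zero-window DOS of `γ₅ D_W(U,−s,1)` integrated over `s ∈ (−1, −max t)` (crossing masses in the gap region), WINDOW
  alone over `s ∈ (−max t, −min t)`, and DEEP + WINDOW at once over `s ∈ (−1, −min t)`; the normalised form, the form
  along a three-flavour datum, and the law-level implication `deepWindowLaw_of_crossingDOSLaw_three` (candidate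
  Hermitian entrance of skeleton v6, the `N_f = 3` analogue of `windowLaw_of_windowDOSLaw_two`).
-/

noncomputable section

namespace Summit.QuantumFields.QCD.Theorems.MobilityGapSketch

open scoped BigOperators Topology
open MeasureTheory Filter Set
open Literature.MathematicalPhysics.QuantumFieldTheory Literature.MathematicalPhysics.QuantumLattice
  Literature.Probability.LatticeModels

/-! ### §A Audit facts -/

/-- A1. The `∃ L`-prefix of `stub_deepWindowAt` is inhabited by the volume floor (landed, any `N_f`). -/
example (d : LineData 3) :
    ∃ L : ℕ → ℕ, Tendsto (fun k => d.a k * (L k : ℝ)) atTop atTop ∧ (∀ᶠ k in atTop, d.vfloor k ≤ L k) :=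
  windowAt_prefix_inhabited d

/-- Below some of finitely many thresholds `−t f` iff below the largest of them, `−min_f t f`. [folklore] -/
theorem exists_lt_neg_iff_lt_neg_inf' {ι : Type*} [Fintype ι] [Nonempty ι] (t : ι → ℝ) (x : ℝ) :
    (∃ f, x < -t f) ↔ x < -Finset.univ.inf' Finset.univ_nonempty t := by
  constructor
  · rintro ⟨f, hf⟩
    exact lt_of_lt_of_le hf (neg_le_neg (Finset.inf'_le t (Finset.mem_univ f)))
  · intro h
    obtain ⟨i, -, hi⟩ := Finset.exists_mem_eq_inf' Finset.univ_nonempty t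
    exact ⟨i, by rw [← hi]; exact h⟩

/-- A2. Degenerate triples: if all bare masses coincide the spread window is empty, the WINDOW count is `0`
(and the DEEP count is the single-flavour count below `−t 0`). [folklore] -/
theorem spreadCount_eq_zero_of_forall_eq (s : Multiset ℂ) (t : Fin 3 → ℝ) (ht : ∀ f g, t f = t g) :
    s.countP (fun z : ℂ => z.im = 0 ∧ (∃ f, z.re < -t f) ∧ ∃ g, -t g < z.re) = 0 := by
  rw [Multiset.countP_eq_zero]
  rintro z - ⟨-, ⟨f, hf⟩, g, hg⟩
  rw [ht f g] at hf
  linarith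

variable {N : ℕ} [NeZero N]

/-- A3 (deep). If SOME bare mass of the triple is `≥ 0` the DEEP count vanishes: a deep mode has
`Re z < −t_f ≤ 0`, but real roots of `charpoly D_W(U,0,1)` have `Re z ∈ [0,8]` (landed `re_mem_Icc_of_real_root`). -/
theorem deepCount_eq_zero_of_exists_nonneg (U : GaugeConfig 4 N (Matrix.specialUnitaryGroup (Fin 3) ℂ))
    (t : Fin 3 → ℝ) (ht : ∃ f, 0 ≤ t f) :
    (wilsonDirac (fundamentalRep (Fin 3)) U 0 1).charpoly.roots.countP
      (fun z : ℂ => z.im = 0 ∧ ∀ f, z.re < -t f) = 0 := by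
  rw [Multiset.countP_eq_zero]
  rintro z hz ⟨hzim, hall⟩
  obtain ⟨f, hf⟩ := ht
  have h1 := (ExtinctionBuildsQCD.Negative.re_mem_Icc_of_real_root U hz hzim).1
  have h2 := hall f
  linarith

/-- A3 (window). If ALL bare masses of the triple are `≥ 0` the WINDOW count vanishes as well. -/
theorem spreadCount_eq_zero_of_forall_nonneg (U : GaugeConfig 4 N (Matrix.specialUnitaryGroup (Fin 3) ℂ))
    (t : Fin 3 → ℝ) (ht : ∀ f, 0 ≤ t f) :
    (wilsonDirac (fundamentalRep (Fin 3)) U 0 1).charpoly.roots.countP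
      (fun z : ℂ => z.im = 0 ∧ (∃ f, z.re < -t f) ∧ ∃ g, -t g < z.re) = 0 := by
  rw [Multiset.countP_eq_zero]
  rintro z hz ⟨hzim, ⟨f, hf⟩, -⟩
  have h1 := (ExtinctionBuildsQCD.Negative.re_mem_Icc_of_real_root U hz hzim).1
  have h2 := ht f
  linarith

/-- A4. Hence the BODY of `stub_deepWindowAt` holds with value `0 ≤ 1/4` at every triple `t ≥ 0` (in particular
whenever `0 ≤ thrD d δ k`): the stub has content only while the threshold is negative. -/
theorem deepWindowBody_of_forall_nonneg (β : ℝ) (t : Fin 3 → ℝ) (ht : ∀ f, 0 ≤ t f) :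
    (∫ U : GaugeConfig 4 N (Matrix.specialUnitaryGroup (Fin 3) ℂ),
        (((wilsonDirac (fundamentalRep (Fin 3)) U 0 1).charpoly.roots.countP
            (fun z : ℂ => z.im = 0 ∧ ∀ f, z.re < -t f) : ℝ) +
          ((wilsonDirac (fundamentalRep (Fin 3)) U 0 1).charpoly.roots.countP
            (fun z : ℂ => z.im = 0 ∧ (∃ f, z.re < -t f) ∧ ∃ g, -t g < z.re) : ℝ)) *
          ∏ f : Fin 3, ‖fermionDet (wilsonDirac (fundamentalRep (Fin 3)) U (t f) 1)‖
        ∂(wilsonMeasure (d := 4) (L := N) (fundamentalRep (Fin 3)) β)) /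
      (∫ U : GaugeConfig 4 N (Matrix.specialUnitaryGroup (Fin 3) ℂ),
        ∏ f : Fin 3, ‖fermionDet (wilsonDirac (fundamentalRep (Fin 3)) U (t f) 1)‖
        ∂(wilsonMeasure (d := 4) (L := N) (fundamentalRep (Fin 3)) β)) ≤ 1 / 4 := by
  have h0 : (fun U : GaugeConfig 4 N (Matrix.specialUnitaryGroup (Fin 3) ℂ) =>
      (((wilsonDirac (fundamentalRep (Fin 3)) U 0 1).charpoly.roots.countP
          (fun z : ℂ => z.im = 0 ∧ ∀ f, z.re < -t f) : ℝ) +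
        ((wilsonDirac (fundamentalRep (Fin 3)) U 0 1).charpoly.roots.countP
          (fun z : ℂ => z.im = 0 ∧ (∃ f, z.re < -t f) ∧ ∃ g, -t g < z.re) : ℝ)) *
        ∏ f : Fin 3, ‖fermionDet (wilsonDirac (fundamentalRep (Fin 3)) U (t f) 1)‖) = fun _ => 0 := by
    funext U
    rw [deepCount_eq_zero_of_exists_nonneg U t ⟨0, ht 0⟩, spreadCount_eq_zero_of_forall_nonneg U t ht,
      Nat.cast_zero, add_zero, zero_mul]
  rw [h0, integral_zero, zero_div]
  norm_num

/-- A5. **DEEP + WINDOW ≤ #{real modes below SOME bare mass}** for every multiset: the two predicates are disjoint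
and each implies `Im z = 0 ∧ ∃ f, Re z < −t_f`. [folklore] -/
theorem countP_deep_add_countP_spread_le_countP_exists (s : Multiset ℂ) (t : Fin 3 → ℝ) :
    s.countP (fun z : ℂ => z.im = 0 ∧ ∀ f, z.re < -t f) +
        s.countP (fun z : ℂ => z.im = 0 ∧ (∃ f, z.re < -t f) ∧ ∃ g, -t g < z.re) ≤
      s.countP (fun z : ℂ => z.im = 0 ∧ ∃ f, z.re < -t f) := by
  classical
  have hdisj : ∀ z : ℂ, ¬ ((z.im = 0 ∧ ∀ f, z.re < -t f) ∧ (z.im = 0 ∧ (∃ f, z.re < -t f) ∧ ∃ g, -t g < z.re)) := by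
    rintro z ⟨⟨-, hall⟩, -, -, g, hg⟩
    exact absurd (hall g) (not_lt.2 hg.le)
  have hsum : s.countP (fun z : ℂ => z.im = 0 ∧ ∀ f, z.re < -t f) +
      s.countP (fun z : ℂ => z.im = 0 ∧ (∃ f, z.re < -t f) ∧ ∃ g, -t g < z.re) =
      s.countP (fun z : ℂ => (z.im = 0 ∧ ∀ f, z.re < -t f) ∨ (z.im = 0 ∧ (∃ f, z.re < -t f) ∧ ∃ g, -t g < z.re)) := by
    rw [Multiset.countP_eq_card_filter, Multiset.countP_eq_card_filter, Multiset.countP_eq_card_filter,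
      ← Multiset.card_add, Multiset.filter_add_filter]
    have h0 : Multiset.filter (fun z : ℂ => (z.im = 0 ∧ ∀ f, z.re < -t f) ∧
        (z.im = 0 ∧ (∃ f, z.re < -t f) ∧ ∃ g, -t g < z.re)) s = 0 :=
      Multiset.filter_eq_nil.2 fun z _ => hdisj z
    rw [h0, add_zero]
  rw [hsum, Multiset.countP_eq_card_filter, Multiset.countP_eq_card_filter]
  refine Multiset.card_le_card (Multiset.monotone_filter_right _ fun z hz => ?_)
  rcases hz with ⟨him, hall⟩ | ⟨him, hex, -⟩
  · exact ⟨him, 0, hall 0⟩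
  · exact ⟨him, hex⟩

/-- A5'. … with EQUALITY as soon as no element of the multiset is real and sits exactly at one of the `−t_f`
(then "not deep" means "strictly above some `−t_g`"). [folklore] -/
theorem countP_deep_add_countP_spread_eq_countP_exists_of (s : Multiset ℂ) (t : Fin 3 → ℝ)
    (hb : ∀ z ∈ s, z.im = 0 → ∀ f, z.re ≠ -t f) :
    s.countP (fun z : ℂ => z.im = 0 ∧ ∀ f, z.re < -t f) +
        s.countP (fun z : ℂ => z.im = 0 ∧ (∃ f, z.re < -t f) ∧ ∃ g, -t g < z.re) =
      s.countP (fun z : ℂ => z.im = 0 ∧ ∃ f, z.re < -t f) := by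
  classical
  have hdisj : ∀ z : ℂ, ¬ ((z.im = 0 ∧ ∀ f, z.re < -t f) ∧ (z.im = 0 ∧ (∃ f, z.re < -t f) ∧ ∃ g, -t g < z.re)) := by
    rintro z ⟨⟨-, hall⟩, -, -, g, hg⟩
    exact absurd (hall g) (not_lt.2 hg.le)
  rw [Multiset.countP_eq_card_filter, Multiset.countP_eq_card_filter, Multiset.countP_eq_card_filter,
    ← Multiset.card_add, Multiset.filter_add_filter]
  have h0 : Multiset.filter (fun z : ℂ => (z.im = 0 ∧ ∀ f, z.re < -t f) ∧
      (z.im = 0 ∧ (∃ f, z.re < -t f) ∧ ∃ g, -t g < z.re)) s = 0 :=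
    Multiset.filter_eq_nil.2 fun z _ => hdisj z
  rw [h0, add_zero]
  congr 1
  refine Multiset.filter_congr fun z hz => ⟨?_, ?_⟩
  · rintro (⟨him, hall⟩ | ⟨him, hex, -⟩)
    · exact ⟨him, 0, hall 0⟩
    · exact ⟨him, hex⟩
  · rintro ⟨him, hex⟩
    by_cases hall : ∀ f, z.re < -t f
    · exact Or.inl ⟨him, hall⟩
    · push Not at hall
      obtain ⟨g, hg⟩ := hall
      exact Or.inr ⟨him, hex, g, lt_of_le_of_ne hg (fun h => hb z hz him g h.symm)⟩

/-- A real root of `charpoly D_W(U,0,1)` at `−m` makes the one-flavour Wilson determinant at bare mass `m` vanish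
(`D_W(U,m,1) = D_W(U,0,1) + m`). [folklore] -/
theorem fermionDet_eq_zero_of_mem_roots (U : GaugeConfig 4 N (Matrix.specialUnitaryGroup (Fin 3) ℂ)) (m : ℝ)
    (h : (-(m : ℂ)) ∈ (wilsonDirac (fundamentalRep (Fin 3)) U 0 1).charpoly.roots) :
    fermionDet (wilsonDirac (fundamentalRep (Fin 3)) U m 1) = 0 := by
  set D₀ := wilsonDirac (fundamentalRep (Fin 3)) U 0 1 with hD₀
  rw [Polynomial.mem_roots (Matrix.charpoly_monic D₀).ne_zero, Polynomial.IsRoot.def, Matrix.eval_charpoly] at h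
  have hadd : wilsonDirac (fundamentalRep (Fin 3)) U m 1 = D₀ + (m : ℂ) • (1 : Matrix _ _ ℂ) := by
    have := Literature.Barriers.QuantumFields.wilsonDirac_add_mass (fundamentalRep (Fin 3)) U 0 m 1
    rw [zero_add] at this
    exact this
  have h1 : Matrix.scalar (TorusSite 4 N × Fin 3 × Fin 4) (-(m : ℂ)) - D₀ = -(D₀ + (m : ℂ) • (1 : Matrix _ _ ℂ)) := by
    rw [Matrix.scalar_apply, ← Matrix.smul_one_eq_diagonal, neg_smul]
    abel
  rw [h1, Matrix.det_neg, mul_eq_zero] at h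
  rcases h with h | h
  · exact absurd h (pow_ne_zero _ (by norm_num))
  · simp only [fermionDet, hadd]
    exact h

/-- A6. **The v6 integrand is the lightest-flavour deep-crosser integrand, pointwise.**  For every gauge field and
triple `t`: `(#deep + #window) · Π_f |det D_W(t_f)| = #{z : Im z = 0, ∃ f, Re z < −t_f} · Π_f |det D_W(t_f)|`.  Either
some real root sits exactly at some `−t_f` — then `det D_W(U,t_f,1) = 0` and both sides vanish — or A5' applies. -/
theorem deepWindowIntegrand_eq_existsIntegrand (U : GaugeConfig 4 N (Matrix.specialUnitaryGroup (Fin 3) ℂ))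
    (t : Fin 3 → ℝ) :
    (((wilsonDirac (fundamentalRep (Fin 3)) U 0 1).charpoly.roots.countP
          (fun z : ℂ => z.im = 0 ∧ ∀ f, z.re < -t f) : ℝ) +
        ((wilsonDirac (fundamentalRep (Fin 3)) U 0 1).charpoly.roots.countP
          (fun z : ℂ => z.im = 0 ∧ (∃ f, z.re < -t f) ∧ ∃ g, -t g < z.re) : ℝ)) *
        ∏ f : Fin 3, ‖fermionDet (wilsonDirac (fundamentalRep (Fin 3)) U (t f) 1)‖ =
      ((wilsonDirac (fundamentalRep (Fin 3)) U 0 1).charpoly.roots.countP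
          (fun z : ℂ => z.im = 0 ∧ ∃ f, z.re < -t f) : ℝ) *
        ∏ f : Fin 3, ‖fermionDet (wilsonDirac (fundamentalRep (Fin 3)) U (t f) 1)‖ := by
  classical
  by_cases hb : ∀ z ∈ (wilsonDirac (fundamentalRep (Fin 3)) U 0 1).charpoly.roots, z.im = 0 → ∀ f, z.re ≠ -t f
  · rw [← countP_deep_add_countP_spread_eq_countP_exists_of _ t hb, Nat.cast_add]
  · push Not at hb
    obtain ⟨z, hz, hzim, f, hzf⟩ := hb
    have hzeq : z = -((t f : ℝ) : ℂ) := Complex.ext (by simp [hzf]) (by simp [hzim])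
    have hdet : fermionDet (wilsonDirac (fundamentalRep (Fin 3)) U (t f) 1) = 0 :=
      fermionDet_eq_zero_of_mem_roots U (t f) (by rw [← hzeq]; exact hz)
    have hw : ∏ f : Fin 3, ‖fermionDet (wilsonDirac (fundamentalRep (Fin 3)) U (t f) 1)‖ = 0 :=
      Finset.prod_eq_zero (Finset.mem_univ f) (by rw [hdet, norm_zero])
    rw [hw, mul_zero, mul_zero]

/-- A7. **v5 ≤ 3 · v6, pointwise.**  The flavour-summed deep-crosser integrand of v5's `ExtinctAt` is at most three
times the v6 integrand: each `#{Re < −t_f} ≤ #{∃ g, Re < −t_g}`, and A6.  (With the landed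
`countP_deep_add_countP_spread_le_sum`: v6-integrand ≤ v5-integrand ≤ 3 · v6-integrand.) -/
theorem extinctIntegrand_le_three_mul_deepWindowIntegrand
    (U : GaugeConfig 4 N (Matrix.specialUnitaryGroup (Fin 3) ℂ)) (t : Fin 3 → ℝ) :
    (∑ f : Fin 3, ((wilsonDirac (fundamentalRep (Fin 3)) U 0 1).charpoly.roots.countP
        (fun z : ℂ => z.im = 0 ∧ z.re < -t f) : ℝ)) *
        ∏ f : Fin 3, ‖fermionDet (wilsonDirac (fundamentalRep (Fin 3)) U (t f) 1)‖ ≤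
      3 * ((((wilsonDirac (fundamentalRep (Fin 3)) U 0 1).charpoly.roots.countP
            (fun z : ℂ => z.im = 0 ∧ ∀ f, z.re < -t f) : ℝ) +
          ((wilsonDirac (fundamentalRep (Fin 3)) U 0 1).charpoly.roots.countP
            (fun z : ℂ => z.im = 0 ∧ (∃ f, z.re < -t f) ∧ ∃ g, -t g < z.re) : ℝ)) *
        ∏ f : Fin 3, ‖fermionDet (wilsonDirac (fundamentalRep (Fin 3)) U (t f) 1)‖) := by
  classical
  rw [deepWindowIntegrand_eq_existsIntegrand U t, ← mul_assoc]
  refine mul_le_mul_of_nonneg_right ?_ (Finset.prod_nonneg fun f _ => norm_nonneg _)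
  set s := (wilsonDirac (fundamentalRep (Fin 3)) U 0 1).charpoly.roots with hs
  have hle : ∀ f : Fin 3, (s.countP (fun z : ℂ => z.im = 0 ∧ z.re < -t f) : ℝ) ≤
      s.countP (fun z : ℂ => z.im = 0 ∧ ∃ g, z.re < -t g) := by
    intro f
    have h : s.countP (fun z : ℂ => z.im = 0 ∧ z.re < -t f) ≤ s.countP (fun z : ℂ => z.im = 0 ∧ ∃ g, z.re < -t g) := by
      rw [Multiset.countP_eq_card_filter, Multiset.countP_eq_card_filter]
      exact Multiset.card_le_card (Multiset.monotone_filter_right _ fun z hz => ⟨hz.1, f, hz.2⟩)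
    exact_mod_cast h
  simp only [Fin.sum_univ_three]
  linarith [hle 0, hle 1, hle 2]

/-- A8. **E₊(v5 integrand) ≤ 3 · E₊(v6 integrand)** on every torus: integrating A7 against the Wilson measure and
dividing by the common normalisation.  With the landed `deepWindowQuotient_le_extinctQuotient_three` the v5 law
`ExtinctAt d` (`N_f = 3`, constant `1/4`) and the v6 law are equivalent up to the constant (`1/4` versus `1/12`). -/
theorem extinctQuotient_le_three_mul_deepWindowQuotient_three (β : ℝ) (t : Fin 3 → ℝ) :
    (∫ U : GaugeConfig 4 N (Matrix.specialUnitaryGroup (Fin 3) ℂ),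
        (∑ f : Fin 3, (Multiset.countP (fun z : ℂ => z.im = 0 ∧ z.re < -t f)
          (wilsonDirac (fundamentalRep (Fin 3)) U 0 1).charpoly.roots : ℝ)) *
          ∏ f : Fin 3, ‖fermionDet (wilsonDirac (fundamentalRep (Fin 3)) U (t f) 1)‖
        ∂(wilsonMeasure (d := 4) (L := N) (fundamentalRep (Fin 3)) β)) /
      (∫ U : GaugeConfig 4 N (Matrix.specialUnitaryGroup (Fin 3) ℂ),
        ∏ f : Fin 3, ‖fermionDet (wilsonDirac (fundamentalRep (Fin 3)) U (t f) 1)‖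
        ∂(wilsonMeasure (d := 4) (L := N) (fundamentalRep (Fin 3)) β)) ≤
    3 * ((∫ U : GaugeConfig 4 N (Matrix.specialUnitaryGroup (Fin 3) ℂ),
        (((wilsonDirac (fundamentalRep (Fin 3)) U 0 1).charpoly.roots.countP
            (fun z : ℂ => z.im = 0 ∧ ∀ f, z.re < -t f) : ℝ) +
          ((wilsonDirac (fundamentalRep (Fin 3)) U 0 1).charpoly.roots.countP
            (fun z : ℂ => z.im = 0 ∧ (∃ f, z.re < -t f) ∧ ∃ g, -t g < z.re) : ℝ)) *
          ∏ f : Fin 3, ‖fermionDet (wilsonDirac (fundamentalRep (Fin 3)) U (t f) 1)‖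
        ∂(wilsonMeasure (d := 4) (L := N) (fundamentalRep (Fin 3)) β)) /
      (∫ U : GaugeConfig 4 N (Matrix.specialUnitaryGroup (Fin 3) ℂ),
        ∏ f : Fin 3, ‖fermionDet (wilsonDirac (fundamentalRep (Fin 3)) U (t f) 1)‖
        ∂(wilsonMeasure (d := 4) (L := N) (fundamentalRep (Fin 3)) β))) := by
  classical
  set μ := wilsonMeasure (d := 4) (L := N) (fundamentalRep (Fin 3)) β with hμ
  set A : GaugeConfig 4 N (Matrix.specialUnitaryGroup (Fin 3) ℂ) → ℝ := fun U =>
    ∏ f : Fin 3, ‖fermionDet (wilsonDirac (fundamentalRep (Fin 3)) U (t f) 1)‖ with hA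
  set W : GaugeConfig 4 N (Matrix.specialUnitaryGroup (Fin 3) ℂ) → ℝ := fun U =>
    (((wilsonDirac (fundamentalRep (Fin 3)) U 0 1).charpoly.roots.countP
        (fun z : ℂ => z.im = 0 ∧ ∀ f, z.re < -t f) : ℝ) +
      ((wilsonDirac (fundamentalRep (Fin 3)) U 0 1).charpoly.roots.countP
        (fun z : ℂ => z.im = 0 ∧ (∃ f, z.re < -t f) ∧ ∃ g, -t g < z.re) : ℝ)) with hW
  set E : GaugeConfig 4 N (Matrix.specialUnitaryGroup (Fin 3) ℂ) → ℝ := fun U =>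
    ∑ f : Fin 3, ((wilsonDirac (fundamentalRep (Fin 3)) U 0 1).charpoly.roots.countP
      (fun z : ℂ => z.im = 0 ∧ z.re < -t f) : ℝ) with hE
  change (∫ U, E U * A U ∂μ) / (∫ U, A U ∂μ) ≤ 3 * ((∫ U, W U * A U ∂μ) / (∫ U, A U ∂μ))
  have hAeq : A = fun U => ‖(diracMatrix U t).det‖ := funext fun U => (norm_det_diracMatrix U t).symm
  have hAi : Integrable A μ := by rw [hAeq]; exact integrable_norm_det_diracMatrix t μ
  have hA0 : ∀ U, 0 ≤ A U := fun U => Finset.prod_nonneg fun f _ => norm_nonneg _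
  have hZ0 : 0 ≤ ∫ U, A U ∂μ := integral_nonneg hA0
  have hWm : Measurable W := by
    refine Measurable.add ?_ ?_
    · exact (measurable_from_nat (f := (Nat.cast : ℕ → ℝ))).comp
        (measurable_countP_charpoly_roots_deep
          (continuous_wilsonDirac (fundamentalRep (Fin 3)) (continuous_fundamentalRep (Fin 3)) 0 1) t)
    · exact (measurable_from_nat (f := (Nat.cast : ℕ → ℝ))).comp
        (measurable_countP_charpoly_roots_spread
          (continuous_wilsonDirac (fundamentalRep (Fin 3)) (continuous_fundamentalRep (Fin 3)) 0 1) t)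
  have hW0 : ∀ U, 0 ≤ W U := fun U => add_nonneg (Nat.cast_nonneg _) (Nat.cast_nonneg _)
  have hE0 : ∀ U, 0 ≤ E U := fun U => Finset.sum_nonneg fun f _ => Nat.cast_nonneg _
  have hEW : ∀ U, E U * A U ≤ 3 * W U * A U := fun U => by
    have := extinctIntegrand_le_three_mul_deepWindowIntegrand U t
    simp only [hW, hE, hA]
    linarith
  have hle : ∀ (U : GaugeConfig 4 N (Matrix.specialUnitaryGroup (Fin 3) ℂ)) (p : ℂ → Prop) [DecidablePred p],
      (((wilsonDirac (fundamentalRep (Fin 3)) U 0 1).charpoly.roots.countP p : ℕ) : ℝ) ≤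
        Fintype.card (TorusSite 4 N × Fin 3 × Fin 4) := by
    intro U p _
    have h1 := Multiset.countP_le_card p (wilsonDirac (fundamentalRep (Fin 3)) U 0 1).charpoly.roots
    have h2 := Polynomial.card_roots' (wilsonDirac (fundamentalRep (Fin 3)) U 0 1).charpoly
    rw [Matrix.charpoly_natDegree_eq_dim] at h2
    exact_mod_cast h1.trans h2
  have hWle : ∀ U, 3 * W U ≤ 6 * Fintype.card (TorusSite 4 N × Fin 3 × Fin 4) := by
    intro U
    simp only [hW]
    linarith [hle U (fun z : ℂ => z.im = 0 ∧ ∀ f, z.re < -t f),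
      hle U (fun z : ℂ => z.im = 0 ∧ (∃ f, z.re < -t f) ∧ ∃ g, -t g < z.re)]
  have hWAi : Integrable (fun U => 3 * W U * A U) μ := by
    refine (hAi.const_mul (6 * Fintype.card (TorusSite 4 N × Fin 3 × Fin 4))).mono'
      ((hWm.const_mul 3).aestronglyMeasurable.mul hAi.aestronglyMeasurable) (Eventually.of_forall fun U => ?_)
    rw [Real.norm_eq_abs, abs_of_nonneg (mul_nonneg (mul_nonneg zero_le_three (hW0 U)) (hA0 U))]
    exact mul_le_mul_of_nonneg_right (hWle U) (hA0 U)
  have hint : ∫ U, E U * A U ∂μ ≤ ∫ U, 3 * W U * A U ∂μ :=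
    integral_mono_of_nonneg (Eventually.of_forall fun U => mul_nonneg (hE0 U) (hA0 U)) hWAi
      (Eventually.of_forall hEW)
  have h3 : ∫ U, 3 * W U * A U ∂μ = 3 * ∫ U, W U * A U ∂μ := by
    rw [← integral_const_mul]
    exact integral_congr_ae (Eventually.of_forall fun U => by ring)
  rw [h3] at hint
  rw [mul_div_assoc']
  exact div_le_div_of_nonneg_right hint hZ0


/-- A9 (law level, registered sub-goal `extinctLaw_of_deepWindowLawTwelfth_three`). **Skeleton v5 and v6 agree up to a
constant on the three-flavour sign side**: if every admissible three-flavour datum carrying a light moment satisfies the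
DEEP + WINDOW law with constant `1/12` (same shell as `stub_deepWindowAt`), then every such datum satisfies v5's
flavour-summed extinction law `ExtinctAt d` (constant `1/4`), by A8; the converse direction (with equal constants) is the
landed `deepWindowLaw_of_extinctLaw_three`. -/
theorem extinctLaw_of_deepWindowLawTwelfth_three :
    (∀ d : LineData 3, LightMomentAt 3 d.a d.β d.s →
      ∃ L : ℕ → ℕ, Tendsto (fun k => d.a k * (L k : ℝ)) atTop atTop ∧ (∀ᶠ k in atTop, d.vfloor k ≤ L k) ∧
        ∀ᶠ δ in atTop, ∀ M : ℝ, 0 < M → ∀ᶠ k in atTop,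
          (floorSetD d δ k).Nonempty → -1 < thrD d δ k → ∀ t : Fin 3 → ℝ,
            (∀ f, thrD d δ k < t f) → (∀ f, t f ≤ thrD d δ k + d.a k * M / d.zm k) →
              (∫ U : GaugeConfig 4 (2 * L k + 1) (Matrix.specialUnitaryGroup (Fin 3) ℂ),
                  (((wilsonDirac (fundamentalRep (Fin 3)) U 0 1).charpoly.roots.countP
                      (fun z : ℂ => z.im = 0 ∧ ∀ f, z.re < -t f) : ℝ) +
                    ((wilsonDirac (fundamentalRep (Fin 3)) U 0 1).charpoly.roots.countP
                      (fun z : ℂ => z.im = 0 ∧ (∃ f, z.re < -t f) ∧ ∃ g, -t g < z.re) : ℝ)) *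
                    ∏ f : Fin 3, ‖fermionDet (wilsonDirac (fundamentalRep (Fin 3)) U (t f) 1)‖
                  ∂(wilsonMeasure (d := 4) (L := 2 * L k + 1) (fundamentalRep (Fin 3)) (d.β k))) /
                (∫ U : GaugeConfig 4 (2 * L k + 1) (Matrix.specialUnitaryGroup (Fin 3) ℂ),
                  ∏ f : Fin 3, ‖fermionDet (wilsonDirac (fundamentalRep (Fin 3)) U (t f) 1)‖
                  ∂(wilsonMeasure (d := 4) (L := 2 * L k + 1) (fundamentalRep (Fin 3)) (d.β k))) ≤ 1 / 12) →
    ∀ d : LineData 3, LightMomentAt 3 d.a d.β d.s → ExtinctAt d := by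
  intro hDW d hd
  obtain ⟨L, hL, hfl, hδ⟩ := hDW d hd
  refine ⟨L, hL, hfl, hδ.mono fun δ hδ' M hM => (hδ' M hM).mono fun k hk hne hthr t ht₁ ht₂ => ?_⟩
  have h := (extinctQuotient_le_three_mul_deepWindowQuotient_three (d.β k) t).trans
    (mul_le_mul_of_nonneg_left (hk hne hthr t ht₁ ht₂) (by norm_num))
  linarith

end Summit.QuantumFields.QCD.Theorems.MobilityGapSketch

end
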